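import Literature.Geometry.Lorentzian.AFEndBreathing
import Literature.Geometry.Lorentzian.AFEndRestrict
import Literature.Geometry.Lorentzian.AFEndChartPullback
import Literature.Geometry.Lorentzian.AsymptoticFlatnessChart
import Literature.Geometry.Lorentzian.AsymptoticFlatnessProofs
import Literature.Geometry.Lorentzian.InitialDataLocality
import Literature.Geometry.Lorentzian.AsymptoticFlatnessTransition
import Literature.Geometry.Manifold.BilinFamilyPullback
import Literature.Geometry.Manifold.BreathingInverse
import Mathlib.Analysis.SpecialFunctions.Trigonometric.ArctanDeriv
import HarnessLib

/-!
# The breathing family of an initial data set: `t ↦ (breathe (σ t))^* d`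

Sequel to `AFEndBreathing.lean` (topic `Geometry/Lorentzian`; explicit construction, everything
PROVED). For breathing data `B : e.BreathingData z₀ r` on a `3`-manifold `X` (an end `e`, a
coordinate ball `ball z₀ r` whose double lies in the exterior region) and an initial data set `d`
on `X`, pull `d` back along the breathing immersions `breathe s`, `s = σ t`, where
`σ t = (s₀/π) arctan t` squashes `ℝ` into the interval `(−s₀/2, s₀/2)` on which all `breathe s`
are immersions (`AFEnd.exists_forall_injective_mfderiv_breathe`) and diffeomorphisms
(`s₀ ≤ Breathing.invScale`, `BreathingInverse.lean`):

* `breatheFamily B d t = d.comap (breathe (σ t))` (`InitialDataSet.comap`); `breatheFamily_zero` —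
  `= d` at `t = 0`;
* `breatheFamily_h_inner_of_not_mem_core`, `…_k_…` — **the family agrees with `d` off the compact
  moved set** `breatheCore` (in particular on every far region `e.far R₁`, `R₁ ≥ ‖z₀‖ + r`,
  `breatheFamily_eq_of_mem_far`);
* `breatheFamily_h_inner_center` — at the centre `x₀ = Φₑ z₀`,
  **`h_{E t}(x₀)(v, w) = (1 + σ t)² h_d(x₀)(v, w)`**, whence `injective_marker`: for `v₀ ≠ 0` the
  marker `t ↦ h_{E t}(x₀)(v₀, v₀)` is injective on `ℝ` (`σ` injective, `1 + σ t > 0`, `h` positive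
  definite) — the device making gluing families injective in their parameter;
* `isVacuumConstraintSolution_breatheFamily` — vacuum data stay vacuum (naturality of the
  constraints, `isVacuumConstraintSolution_comap'`);
* `contMDiff_breatheFamily_h`, `contMDiff_breatheFamily_k` — **the family is jointly smooth in
  `(t, x)`** (`IsSmoothDataFamily`-shape): off the moved set it is constant in `t`; on the
  coordinate ball its sections are `coord^*(c_t)` for the smooth family of bilinear-form fields
  `c_t = (φ_{σ t})^*(hCoeff e d)` on `ℝ³` (`BilinFamilyPullback.lean`).

## References

* J. M. Lee, *Introduction to Smooth Manifolds*, 2nd ed. (2013), Ch. 2, Prop. 2.25. [LeeSmoothManifolds2013]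
* R. Bartnik, J. Isenberg, *The constraint equations* (2004), §2 (diffeomorphism equivariance).
  [BartnikIsenberg2004]
-/

noncomputable section

open Bundle Set Filter TopologicalSpace Metric Function
open scoped Manifold ContDiff Topology
open Literature.Geometry.Manifold

namespace Literature.Geometry.Lorentzian

namespace AFEnd

variable {X : Type} [TopologicalSpace X] [ChartedSpace E3 X] [T2Space X]
  {e : AFEnd X} {z₀ : E3} {r : ℝ} (B : BreathingData e z₀ r)

/-! ### The admissible parameter range and the squashing `σ` -/

/-- A bound `s₀ ∈ (0, 1]` below which all `breathe s` are immersions (a choice from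
`exists_forall_injective_mfderiv_breathe`) AND diffeomorphisms (`≤ Breathing.invScale`, the inverse
threshold of `BreathingInverse.lean`). [folklore] -/
def breatheScale (B : BreathingData e z₀ r) : ℝ :=
  min (Classical.choose (exists_forall_injective_mfderiv_breathe B)) (Breathing.invScale z₀ B.r_pos)

/-- The defining properties of `breatheScale`. [folklore] -/
theorem breatheScale_spec :
    0 < breatheScale B ∧ breatheScale B ≤ 1 ∧ ∀ s : ℝ, |s| < breatheScale B →
      ∀ x : X, Injective (mfderiv (𝓡 3) (𝓡 3) (e.breathe z₀ r s) x) := by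
  obtain ⟨h0, h1, h2⟩ := Classical.choose_spec (exists_forall_injective_mfderiv_breathe B)
  exact ⟨lt_min h0 (Breathing.invScale_pos z₀ B.r_pos), (min_le_left _ _).trans h1,
    fun s hs x ↦ h2 s (lt_of_lt_of_le hs (min_le_left _ _)) x⟩

/-- `breatheScale ≤ Breathing.invScale`: below the scale the breathing maps are diffeomorphisms. [folklore] -/
theorem breatheScale_le_invScale : breatheScale B ≤ Breathing.invScale z₀ B.r_pos := min_le_right _ _

/-- The **squashing** `σ t = (s₀/π) arctan t`: smooth, injective, `σ 0 = 0`, `|σ t| < s₀/2`. [folklore] -/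
def squash (B : BreathingData e z₀ r) (t : ℝ) : ℝ := breatheScale B / Real.pi * Real.arctan t

/-- `σ 0 = 0`. [folklore] -/
@[simp] theorem squash_zero : squash B 0 = 0 := by simp [squash]

/-- `σ` is smooth. [folklore] -/
theorem contDiff_squash {n : ℕ∞} : ContDiff ℝ n (squash B) :=
  contDiff_const.mul Real.contDiff_arctan

/-- `σ` is injective. [folklore] -/
theorem squash_injective : Injective (squash B) := by
  intro t t' h
  have hc : breatheScale B / Real.pi ≠ 0 := div_ne_zero (breatheScale_spec B).1.ne' Real.pi_pos.ne'
  exact Real.arctan_injective (mul_left_cancel₀ hc h)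

/-- `|σ t| < s₀ / 2 ≤ 1/2`. [folklore] -/
theorem abs_squash_lt (t : ℝ) : |squash B t| < breatheScale B / 2 := by
  have hs := (breatheScale_spec B).1
  rw [squash, abs_mul, abs_of_pos (div_pos hs Real.pi_pos)]
  have h : |Real.arctan t| < Real.pi / 2 :=
    abs_lt.2 ⟨Real.neg_pi_div_two_lt_arctan t, Real.arctan_lt_pi_div_two t⟩
  calc breatheScale B / Real.pi * |Real.arctan t|
      < breatheScale B / Real.pi * (Real.pi / 2) := mul_lt_mul_of_pos_left h (div_pos hs Real.pi_pos)
    _ = breatheScale B / 2 := by field_simp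

/-- `|σ t|` is below the inverse threshold (so `breathe (σ t)` is a diffeomorphism). [folklore] -/
theorem abs_squash_lt_invScale (t : ℝ) : |squash B t| < Breathing.invScale z₀ B.r_pos := by
  have h := abs_squash_lt B t
  have h0 := (breatheScale_spec B).1
  have hle := breatheScale_le_invScale B
  linarith

/-- `|σ t| < s₀` (so `breathe (σ t)` is an immersion) and `|σ t| < 1`. [folklore] -/
theorem abs_squash_lt_scale (t : ℝ) : |squash B t| < breatheScale B ∧ |squash B t| < 1 := by
  have h := abs_squash_lt B t
  have hs := (breatheScale_spec B).1
  have h1 := (breatheScale_spec B).2.1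
  exact ⟨by linarith, by linarith⟩

/-- `0 < 1 + σ t`. [folklore] -/
theorem one_add_squash_pos (t : ℝ) : 0 < 1 + squash B t := by
  have h := (abs_squash_lt_scale B t).2
  have := neg_abs_le (squash B t)
  linarith

/-! ### The family -/

variable [IsManifold (𝓡 3) ∞ X]

/-- **The breathing family** `E t = (breathe (σ t))^* d` of an initial data set `d`.
[cite: BartnikIsenberg2004, §2] -/
def breatheFamily (B : BreathingData e z₀ r) (d : InitialDataSet (𝓡 3) X) (t : ℝ) : InitialDataSet (𝓡 3) X :=
  d.comap (e.breathe z₀ r (squash B t)) (contMDiff_breathe_succ B (abs_squash_lt_scale B t).2)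
    ((breatheScale_spec B).2.2 _ (abs_squash_lt_scale B t).1)

variable (d : InitialDataSet (𝓡 3) X)

/-- The metric of the breathing family: `h_{E t}(x)(v, w) = h_d(Φ x)(dΦ v, dΦ w)`, `Φ = breathe (σ t)`.
[cite: BartnikIsenberg2004, §2] -/
theorem breatheFamily_h_inner (t : ℝ) (x : X) (v w : TangentSpace (𝓡 3) x) :
    (breatheFamily B d t).h.inner x v w =
      d.h.inner (e.breathe z₀ r (squash B t) x) (mfderiv (𝓡 3) (𝓡 3) (e.breathe z₀ r (squash B t)) x v)
        (mfderiv (𝓡 3) (𝓡 3) (e.breathe z₀ r (squash B t)) x w) := rfl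

/-- The tensor `k` of the breathing family: `k_{E t}(x)(v, w) = k_d(Φ x)(dΦ v, dΦ w)`. [cite: BartnikIsenberg2004, §2] -/
theorem breatheFamily_k (t : ℝ) (x : X) (v w : TangentSpace (𝓡 3) x) :
    (breatheFamily B d t).k x v w =
      d.k (e.breathe z₀ r (squash B t) x) (mfderiv (𝓡 3) (𝓡 3) (e.breathe z₀ r (squash B t)) x v)
        (mfderiv (𝓡 3) (𝓡 3) (e.breathe z₀ r (squash B t)) x w) := rfl

/-- **At `t = 0` the family is `d`** (`σ 0 = 0`, `breathe 0 = id`). [folklore] -/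
theorem breatheFamily_zero : breatheFamily B d 0 = d :=
  d.comap_eq_self_of_eq_id _ _ (by rw [squash_zero, breathe_zero_eq])

/-- **Off the moved set the family agrees with `d`** (there `breathe = id` near `x`, `dΦ = id`).
[cite: LeeSmoothManifolds2013, Prop. 2.25] -/
theorem breatheFamily_eq_of_not_mem_core (t : ℝ) {x : X} (hx : x ∉ breatheCore e z₀ r) :
    (breatheFamily B d t).h.inner x = d.h.inner x ∧ (breatheFamily B d t).k x = d.k x := by
  have hid := mfderiv_breathe_of_not_mem_core B (s := squash B t) hx
  have hpt := breathe_eq_self_of_not_mem_core B (s := squash B t) hx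
  have keyh : ∀ (p : X) (hp : p = x) (L : TangentSpace (𝓡 3) x →L[ℝ] TangentSpace (𝓡 3) p)
      (_ : ∀ v, HEq (L v) v) (v w : TangentSpace (𝓡 3) x), d.h.inner p (L v) (L w) = d.h.inner x v w := by
    rintro p rfl L hL v w
    have hv : L v = v := eq_of_heq (hL v)
    have hw : L w = w := eq_of_heq (hL w)
    rw [hv, hw]
  have keyk : ∀ (p : X) (hp : p = x) (L : TangentSpace (𝓡 3) x →L[ℝ] TangentSpace (𝓡 3) p)
      (_ : ∀ v, HEq (L v) v) (v w : TangentSpace (𝓡 3) x), d.k p (L v) (L w) = d.k x v w := by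
    rintro p rfl L hL v w
    have hv : L v = v := eq_of_heq (hL v)
    have hw : L w = w := eq_of_heq (hL w)
    rw [hv, hw]
  have hL : ∀ v : TangentSpace (𝓡 3) x,
      HEq (mfderiv (𝓡 3) (𝓡 3) (e.breathe z₀ r (squash B t)) x v) v := fun v ↦ by
    rw [hid]
    rfl
  refine ⟨?_, ?_⟩
  · ext v w
    rw [breatheFamily_h_inner]
    exact keyh _ hpt _ hL v w
  · ext v w
    rw [breatheFamily_k]
    exact keyk _ hpt _ hL v w

/-- **On far regions the family agrees with `d`** (`R₁ ≥ ‖z₀‖ + r`). [cite: Bartnik1986, §1] -/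
theorem breatheFamily_eq_of_mem_far (t : ℝ) {R₁ : ℝ} (hR₁ : ‖z₀‖ + r ≤ R₁) {x : X} (hx : x ∈ e.far R₁) :
    (breatheFamily B d t).h.inner x = d.h.inner x ∧ (breatheFamily B d t).k x = d.k x :=
  breatheFamily_eq_of_not_mem_core B d t fun hK ↦ not_mem_far_of_mem_core B hR₁ hK hx

/-! ### The marker at the centre -/

/-- **The marker**: at the centre `x₀ = Φₑ z₀`, `h_{E t}(x₀)(v, w) = (1 + σ t)² h_d(x₀)(v, w)`
(`breathe` fixes `x₀` and `d(breathe (σ t))(x₀) = (1 + σ t) • id`). [cite: LeeSmoothManifolds2013, Prop. 2.25] -/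
theorem breatheFamily_h_inner_center (t : ℝ) (v w : TangentSpace (𝓡 3) (e.dataChartExt z₀)) :
    (breatheFamily B d t).h.inner (e.dataChartExt z₀) v w =
      (1 + squash B t) ^ 2 * d.h.inner (e.dataChartExt z₀) v w := by
  have hs := (abs_squash_lt_scale B t).2
  have hpt := breathe_center B (squash B t)
  have key : ∀ (p : X) (hp : p = e.dataChartExt z₀)
      (L : TangentSpace (𝓡 3) (e.dataChartExt z₀) →L[ℝ] TangentSpace (𝓡 3) p)
      (_ : ∀ u, HEq (L u) ((1 + squash B t) • u)) (v w : TangentSpace (𝓡 3) (e.dataChartExt z₀)),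
      d.h.inner p (L v) (L w) = (1 + squash B t) ^ 2 * d.h.inner (e.dataChartExt z₀) v w := by
    rintro p rfl L hL v w
    rw [eq_of_heq (hL v), eq_of_heq (hL w)]
    simp only [map_smul, smul_apply, smul_eq_mul]
    ring
  rw [breatheFamily_h_inner]
  refine key _ hpt _ (fun u ↦ ?_) v w
  rw [mfderiv_breathe_center B hs u]
  rfl

/-- **The marker is injective in `t`** for `v₀ ≠ 0`: `t ↦ h_{E t}(x₀)(v₀, v₀) = (1 + σ t)² h_d(x₀)(v₀,v₀)`
with `h_d(x₀)(v₀, v₀) > 0`, `1 + σ t > 0` and `σ` injective. [cite: LeeSmoothManifolds2013, Prop. 2.25] -/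
theorem injective_marker {v₀ : TangentSpace (𝓡 3) (e.dataChartExt z₀)} (hv₀ : v₀ ≠ 0) :
    Injective fun t : ℝ ↦ (breatheFamily B d t).h.inner (e.dataChartExt z₀) v₀ v₀ := by
  intro t t' h
  simp only [breatheFamily_h_inner_center] at h
  have hpos : 0 < d.h.inner (e.dataChartExt z₀) v₀ v₀ := d.h.pos _ v₀ hv₀
  have h1 : (1 + squash B t) ^ 2 = (1 + squash B t') ^ 2 := mul_right_cancel₀ hpos.ne' h
  have h2 : 1 + squash B t = 1 + squash B t' := by
    have ha := one_add_squash_pos B t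
    have hb := one_add_squash_pos B t'
    nlinarith [sq_nonneg (squash B t - squash B t'), sq_nonneg (squash B t + squash B t' + 2)]
  exact squash_injective B (by linarith)

/-! ### Vacuum -/

/-- **The breathing family of vacuum data is vacuum** (naturality of the constraints under local
diffeomorphisms). [cite: BartnikIsenberg2004, §2] -/
theorem isVacuumConstraintSolution_breatheFamily [d.metric.HasLeviCivita] (hd : d.IsVacuumConstraintSolution)
    (t : ℝ) [(breatheFamily B d t).metric.HasLeviCivita] : (breatheFamily B d t).IsVacuumConstraintSolution := by
  haveI : (d.comap (e.breathe z₀ r (squash B t)) (contMDiff_breathe_succ B (abs_squash_lt_scale B t).2)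
      ((breatheScale_spec B).2.2 _ (abs_squash_lt_scale B t).1)).metric.HasLeviCivita := ‹_›
  exact d.isVacuumConstraintSolution_comap' _ _ hd


/-! ### Joint smoothness of the breathing family -/

/-- The field on `ℝ³` whose pullback along `coord` is a section of the breathing family on the
carrier: `breatheCoeff H s = (φ_s)^* H`, `(breatheCoeff H s)_z (a, b) = H (φ_s z) (dφ_s a, dφ_s b)`. [folklore] -/
def breatheCoeff (z₀ : E3) (r : ℝ) (H : E3 → E3 →L[ℝ] E3 →L[ℝ] ℝ) (s : ℝ) (z : E3) : E3 →L[ℝ] E3 →L[ℝ] ℝ :=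
  ((fderiv ℝ (Breathing.phi z₀ r s) z).precomp ℝ).comp ((H (Breathing.phi z₀ r s z)).comp
    (fderiv ℝ (Breathing.phi z₀ r s) z))

omit [TopologicalSpace X] [ChartedSpace E3 X] [T2Space X] in
/-- `breatheCoeff H s` is the pullback on `ℝ³` of `H` along `φ_s`. [folklore] -/
theorem breatheCoeff_eq_pullbackBilin (z₀ : E3) (r : ℝ) (H : E3 → E3 →L[ℝ] E3 →L[ℝ] ℝ) (s : ℝ) (z : E3) :
    breatheCoeff z₀ r H s z = pullbackBilin (I := 𝓘(ℝ, E3)) (I' := 𝓘(ℝ, E3)) (Breathing.phi z₀ r s)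
      (show Π z : E3, TangentSpace 𝓘(ℝ, E3) z →L[ℝ] TangentSpace 𝓘(ℝ, E3) z →L[ℝ] ℝ from H) z := by
  unfold breatheCoeff pullbackBilin
  rw [mfderiv_eq_fderiv]
  rfl

omit [TopologicalSpace X] [ChartedSpace E3 X] [T2Space X] in
/-- **`(s, z) ↦ breatheCoeff H (τ s) z` is smooth at `(t₀, z₁)` when `H` is smooth at `φ_{τ t₀} z₁`**
(calculus: `H ∘ φ`, the parametric derivative `(s, z) ↦ dφ_{τ s}(z)` (`ContDiff.fderiv`) and
composition of continuous linear maps), as a `C^∞` map on the product manifold `ℝ × ℝ³`. [folklore] -/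
theorem contMDiffAt_breatheCoeff (z₀ : E3) (r : ℝ) {H : E3 → E3 →L[ℝ] E3 →L[ℝ] ℝ} {τ : ℝ → ℝ}
    (hτ : ContDiff ℝ ∞ τ) {t₀ : ℝ} {z₁ : E3} (hH : ContDiffAt ℝ ∞ H (Breathing.phi z₀ r (τ t₀) z₁)) :
    ContMDiffAt (𝓘(ℝ, ℝ).prod 𝓘(ℝ, E3)) 𝓘(ℝ, E3 →L[ℝ] E3 →L[ℝ] ℝ) ∞
      (fun q : ℝ × E3 ↦ breatheCoeff z₀ r H (τ q.1) q.2) (t₀, z₁) := by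
  -- `(q, z) ↦ φ (τ q.1) z` is smooth jointly in `(q, z)`, so `q ↦ dφ_{τ q.1}(q.2)` is smooth
  have hφ2 : ContDiff ℝ ∞ (uncurry fun (q : ℝ × E3) (z : E3) ↦ Breathing.phi z₀ r (τ q.1) z) :=
    (Breathing.contDiff_uncurry_phi z₀ r (n := ⊤)).comp
      ((hτ.comp (contDiff_fst.comp contDiff_fst)).prodMk contDiff_snd)
  have hA : ContDiff ℝ ∞ (fun q : ℝ × E3 ↦ fderiv ℝ (Breathing.phi z₀ r (τ q.1)) q.2) :=
    hφ2.fderiv contDiff_snd le_rfl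
  have hφ1 : ContDiff ℝ ∞ (fun q : ℝ × E3 ↦ Breathing.phi z₀ r (τ q.1) q.2) :=
    (Breathing.contDiff_uncurry_phi z₀ r (n := ⊤)).comp ((hτ.comp contDiff_fst).prodMk contDiff_snd)
  -- pass to the product manifold `ℝ × ℝ³`
  have hid : ContMDiffAt (𝓘(ℝ, ℝ).prod 𝓘(ℝ, E3)) 𝓘(ℝ, ℝ × E3) ∞ (fun q : ℝ × E3 ↦ (q.1, q.2)) (t₀, z₁) :=
    contMDiffAt_fst.prodMk_space contMDiffAt_snd
  have hA' : ContMDiffAt (𝓘(ℝ, ℝ).prod 𝓘(ℝ, E3)) 𝓘(ℝ, E3 →L[ℝ] E3) ∞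
      (fun q : ℝ × E3 ↦ fderiv ℝ (Breathing.phi z₀ r (τ q.1)) q.2) (t₀, z₁) :=
    hA.contDiffAt.comp_contMDiffAt hid
  have hφ' : ContMDiffAt (𝓘(ℝ, ℝ).prod 𝓘(ℝ, E3)) 𝓘(ℝ, E3) ∞
      (fun q : ℝ × E3 ↦ Breathing.phi z₀ r (τ q.1) q.2) (t₀, z₁) :=
    hφ1.contDiffAt.comp_contMDiffAt hid
  have hHφ' : ContMDiffAt (𝓘(ℝ, ℝ).prod 𝓘(ℝ, E3)) 𝓘(ℝ, E3 →L[ℝ] E3 →L[ℝ] ℝ) ∞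
      (fun q : ℝ × E3 ↦ H (Breathing.phi z₀ r (τ q.1) q.2)) (t₀, z₁) :=
    ContMDiffAt.comp (t₀, z₁) hH.contMDiffAt hφ'
  exact (hA'.clm_precomp (F₃ := ℝ)).clm_comp (hHφ'.clm_comp hA')

omit [IsManifold (𝓡 3) ∞ X] in
/-- **On the carrier the sections of the breathing family are pullbacks along `coord`** of the
fields `breatheCoeff H (σ t)`, for `H = hCoeff e d` resp. `kCoeff e d`:
`Φ^*(coord^* H) = (coord ∘ Φ)^* H = (φ ∘ coord)^* H = coord^*(φ^* H)`, `Φ = breathe (σ t)`. [folklore] -/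
theorem pullbackBilin_breathe_eq_of_mem_carrier (t : ℝ) {x : X} (hx : x ∈ e.breatheCarrier z₀ r)
    {b : Π y : X, TangentSpace (𝓡 3) y →L[ℝ] TangentSpace (𝓡 3) y →L[ℝ] ℝ} {H : E3 → E3 →L[ℝ] E3 →L[ℝ] ℝ}
    (hb : ∀ y ∈ e.U, b y = pullbackBilin (I := 𝓘(ℝ, E3)) (I' := 𝓡 3) e.coord
      (show Π z : E3, TangentSpace 𝓘(ℝ, E3) z →L[ℝ] TangentSpace 𝓘(ℝ, E3) z →L[ℝ] ℝ from H) y) :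
    pullbackBilin (I := 𝓡 3) (I' := 𝓡 3) (e.breathe z₀ r (squash B t)) b x =
      pullbackBilin (I := 𝓘(ℝ, E3)) (I' := 𝓡 3) e.coord
        (show Π z : E3, TangentSpace 𝓘(ℝ, E3) z →L[ℝ] TangentSpace 𝓘(ℝ, E3) z →L[ℝ] ℝ from
          breatheCoeff z₀ r H (squash B t)) x := by
  have hs := (abs_squash_lt_scale B t).2
  obtain ⟨hΦU, -⟩ := breathe_mem_and_coord B hs hx
  have hΦd : MDifferentiableAt (𝓡 3) (𝓡 3) (e.breathe z₀ r (squash B t)) x :=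
    (contMDiff_breathe B hs x).mdifferentiableAt (by simp)
  have hcd : MDifferentiableAt (𝓡 3) 𝓘(ℝ, E3) e.coord (e.breathe z₀ r (squash B t) x) :=
    (e.contMDiffAt_coord hΦU).mdifferentiableAt (by simp)
  have hcx : MDifferentiableAt (𝓡 3) 𝓘(ℝ, E3) e.coord x := (e.contMDiffAt_coord hx.1).mdifferentiableAt (by simp)
  have hφd : MDifferentiableAt 𝓘(ℝ, E3) 𝓘(ℝ, E3) (Breathing.phi z₀ r (squash B t)) (e.coord x) :=
    ((Breathing.contDiff_phi z₀ r (squash B t) (n := 1)).differentiable one_ne_zero _).mdifferentiableAt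
  have step2 : pullbackBilin (I := 𝓡 3) (I' := 𝓡 3) (e.breathe z₀ r (squash B t)) b x =
      pullbackBilin (I := 𝓡 3) (I' := 𝓡 3) (e.breathe z₀ r (squash B t))
        (fun y ↦ pullbackBilin (I := 𝓘(ℝ, E3)) (I' := 𝓡 3) e.coord
          (show Π z : E3, TangentSpace 𝓘(ℝ, E3) z →L[ℝ] TangentSpace 𝓘(ℝ, E3) z →L[ℝ] ℝ from H) y) x := by
    ext v w
    rw [pullbackBilin_apply, pullbackBilin_apply, hb _ hΦU]
  have step3 := (pullbackBilin_comp_apply' (IN := 𝓡 3) (IM := 𝓡 3) (IP := 𝓘(ℝ, E3)) hcd hΦd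
    (show Π z : E3, TangentSpace 𝓘(ℝ, E3) z →L[ℝ] TangentSpace 𝓘(ℝ, E3) z →L[ℝ] ℝ from H)).symm
  have hev : (e.coord ∘ e.breathe z₀ r (squash B t)) =ᶠ[𝓝 x] (Breathing.phi z₀ r (squash B t) ∘ e.coord) := by
    filter_upwards [(e.isOpen_breatheCarrier z₀ r).mem_nhds hx] with y hy
    exact (breathe_mem_and_coord B hs hy).2
  have step4 := pullbackBilin_congr_of_eventuallyEq (IN := 𝓡 3) (IM := 𝓘(ℝ, E3)) hev
    (show Π z : E3, TangentSpace 𝓘(ℝ, E3) z →L[ℝ] TangentSpace 𝓘(ℝ, E3) z →L[ℝ] ℝ from H)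
  have step5 := pullbackBilin_comp_apply' (IN := 𝓡 3) (IM := 𝓘(ℝ, E3)) (IP := 𝓘(ℝ, E3)) hφd hcx
    (show Π z : E3, TangentSpace 𝓘(ℝ, E3) z →L[ℝ] TangentSpace 𝓘(ℝ, E3) z →L[ℝ] ℝ from H)
  rw [step2, step3, step4, step5]
  congr 1
  funext z
  exact (breatheCoeff_eq_pullbackBilin z₀ r H (squash B t) z).symm

/-- Joint smoothness of `(t, x) ↦ (Φ_{σ t})^* b` for a smooth section `b` which on the end is
`coord^* H` with `H` smooth on the exterior region — the common proof of
`contMDiff_breatheFamily_h` and `contMDiff_breatheFamily_k`. [cite: LeeSmoothManifolds2013, Prop. 2.25] -/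
theorem contMDiff_pullbackBilin_breathe_family
    {b : Π y : X, TangentSpace (𝓡 3) y →L[ℝ] TangentSpace (𝓡 3) y →L[ℝ] ℝ} {H : E3 → E3 →L[ℝ] E3 →L[ℝ] ℝ}
    (hbs : ContMDiff (𝓡 3) ((𝓡 3).prod 𝓘(ℝ, E3 →L[ℝ] E3 →L[ℝ] ℝ)) ∞
      (fun y : X ↦ TotalSpace.mk' (E3 →L[ℝ] E3 →L[ℝ] ℝ)
        (E := fun x : X ↦ TangentSpace (𝓡 3) x →L[ℝ] TangentSpace (𝓡 3) x →L[ℝ] ℝ) y (b y)))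
    (hb : ∀ y ∈ e.U, b y = pullbackBilin (I := 𝓘(ℝ, E3)) (I' := 𝓡 3) e.coord
      (show Π z : E3, TangentSpace 𝓘(ℝ, E3) z →L[ℝ] TangentSpace 𝓘(ℝ, E3) z →L[ℝ] ℝ from H) y)
    (hH : ∀ z : E3, e.R < ‖z‖ → ContDiffAt ℝ ∞ H z) :
    ContMDiff (𝓘(ℝ, ℝ).prod (𝓡 3)) ((𝓡 3).prod 𝓘(ℝ, E3 →L[ℝ] E3 →L[ℝ] ℝ)) ∞
      (fun p : ℝ × X ↦ TotalSpace.mk' (E3 →L[ℝ] E3 →L[ℝ] ℝ)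
        (E := fun x : X ↦ TangentSpace (𝓡 3) x →L[ℝ] TangentSpace (𝓡 3) x →L[ℝ] ℝ) p.2
        (pullbackBilin (I := 𝓡 3) (I' := 𝓡 3) (e.breathe z₀ r (squash B p.1)) b p.2)) := by
  rintro ⟨t, x⟩
  by_cases hx : x ∈ e.breatheCarrier z₀ r
  · -- on the carrier: pullback along `coord` of a smooth family of fields on `ℝ³`
    have hz : e.R < ‖Breathing.phi z₀ r (squash B t) (e.coord x)‖ :=
      B.R_lt_norm_phi (abs_squash_lt_scale B t).2 hx.2
    have hc' : ContMDiffAt (𝓘(ℝ, ℝ).prod 𝓘(ℝ, E3)) 𝓘(ℝ, E3 →L[ℝ] E3 →L[ℝ] ℝ) ∞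
        (fun q : ℝ × E3 ↦ breatheCoeff z₀ r H (squash B q.1) q.2) (t, e.coord x) :=
      contMDiffAt_breatheCoeff z₀ r (contDiff_squash B (n := ⊤)) (hH _ hz)
    have hmain := contMDiffAt_pullbackBilin_family (IP := 𝓘(ℝ, ℝ)) (I' := 𝓡 3) (n := ∞) (p₀ := t)
      (c := fun (s : ℝ) (z : E3) ↦ breatheCoeff z₀ r H (squash B s) z)
      (e.contMDiffAt_coord hx.1) hc'
    refine hmain.congr_of_eventuallyEq ?_
    have hev : ∀ᶠ q : ℝ × X in 𝓝 (t, x), q.2 ∈ e.breatheCarrier z₀ r :=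
      (continuousAt_snd (p := (t, x))).preimage_mem_nhds ((e.isOpen_breatheCarrier z₀ r).mem_nhds hx)
    filter_upwards [hev] with q hq
    rw [pullbackBilin_breathe_eq_of_mem_carrier B q.1 hq hb]
  · -- off the carrier (hence off the moved set): locally the constant family `b`
    have hK : x ∉ breatheCore e z₀ r := fun h ↦ hx (breatheCore_subset_carrier B h)
    have hconst : ContMDiffAt (𝓘(ℝ, ℝ).prod (𝓡 3)) ((𝓡 3).prod 𝓘(ℝ, E3 →L[ℝ] E3 →L[ℝ] ℝ)) ∞
        (fun p : ℝ × X ↦ TotalSpace.mk' (E3 →L[ℝ] E3 →L[ℝ] ℝ)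
          (E := fun x : X ↦ TangentSpace (𝓡 3) x →L[ℝ] TangentSpace (𝓡 3) x →L[ℝ] ℝ) p.2 (b p.2)) (t, x) :=
      (hbs x).comp (t, x) contMDiffAt_snd
    refine hconst.congr_of_eventuallyEq ?_
    have hev : ∀ᶠ q : ℝ × X in 𝓝 (t, x), q.2 ∉ breatheCore e z₀ r :=
      (continuousAt_snd (p := (t, x))).preimage_mem_nhds
        ((isCompact_breatheCore B).isClosed.isOpen_compl.mem_nhds hK)
    filter_upwards [hev] with q hq
    have hid := mfderiv_breathe_of_not_mem_core B (s := squash B q.1) hq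
    have hpt := breathe_eq_self_of_not_mem_core B (s := squash B q.1) hq
    have key : ∀ (p : X) (_ : p = q.2) (L : TangentSpace (𝓡 3) q.2 →L[ℝ] TangentSpace (𝓡 3) p)
        (_ : ∀ v, HEq (L v) v) (v w : TangentSpace (𝓡 3) q.2), b p (L v) (L w) = b q.2 v w := by
      rintro p rfl L hL v w
      rw [eq_of_heq (hL v), eq_of_heq (hL w)]
    have hL : ∀ v : TangentSpace (𝓡 3) q.2,
        HEq (mfderiv (𝓡 3) (𝓡 3) (e.breathe z₀ r (squash B q.1)) q.2 v) v := fun v ↦ by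
      rw [hid]
      rfl
    congr 1
    ext v w
    rw [pullbackBilin_apply]
    exact key _ hpt _ hL v w

/-- **The metric of the breathing family is jointly smooth in `(t, x)`.** [cite: LeeSmoothManifolds2013, Prop. 2.25] -/
theorem contMDiff_breatheFamily_h :
    ContMDiff (𝓘(ℝ, ℝ).prod (𝓡 3)) ((𝓡 3).prod 𝓘(ℝ, E3 →L[ℝ] E3 →L[ℝ] ℝ)) ∞
      (fun p : ℝ × X ↦ TotalSpace.mk' (E3 →L[ℝ] E3 →L[ℝ] ℝ)
        (E := fun x : X ↦ TangentSpace (𝓡 3) x →L[ℝ] TangentSpace (𝓡 3) x →L[ℝ] ℝ) p.2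
        ((breatheFamily B d p.1).h.inner p.2)) :=
  contMDiff_pullbackBilin_breathe_family B (b := d.h.inner) (H := hCoeff e d) d.h.contMDiff
    (fun _ hy ↦ h_inner_eq_pullbackBilin_coord d hy) (fun _ hz ↦ e.contDiffAt_hCoeff d hz)

/-- **`k` of the breathing family is jointly smooth in `(t, x)`.** [cite: LeeSmoothManifolds2013, Prop. 2.25] -/
theorem contMDiff_breatheFamily_k :
    ContMDiff (𝓘(ℝ, ℝ).prod (𝓡 3)) ((𝓡 3).prod 𝓘(ℝ, E3 →L[ℝ] E3 →L[ℝ] ℝ)) ∞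
      (fun p : ℝ × X ↦ TotalSpace.mk' (E3 →L[ℝ] E3 →L[ℝ] ℝ)
        (E := fun x : X ↦ TangentSpace (𝓡 3) x →L[ℝ] TangentSpace (𝓡 3) x →L[ℝ] ℝ) p.2
        ((breatheFamily B d p.1).k p.2)) :=
  contMDiff_pullbackBilin_breathe_family B (b := d.k) (H := kCoeff e d) d.contMDiff_k
    (fun _ hy ↦ k_eq_pullbackBilin_coord d hy)
    (fun _ hz ↦ (ContDiffOn_kCoeff_holds e d).contDiffAt ((isOpen_lt continuous_const continuous_norm).mem_nhds hz))

end AFEnd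

end Literature.Geometry.Lorentzian

end
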